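import Summits.BirchSwinnertonDyer.BirchSwinnertonDyer.Theorems.GenusKolyvaginAtTwoShaCardDvdPowAtTwoRTShaFiniteAtTwoRat
import Summits.BirchSwinnertonDyer.BirchSwinnertonDyer.Theorems.GenusKolyvaginAtTwoShaCardDvdPowAtTwoRTShaFiniteAtTwoCTQ
import Summits.BirchSwinnertonDyer.BirchSwinnertonDyer.Theorems.GenusKolyvaginAtTwoShaCardDvdPowAtTwoRTShaFiniteAtTwoTwinShaTrivial
import Summits.BirchSwinnertonDyer.BirchSwinnertonDyer.Theorems.GenusKolyvaginAtTwoShaCardDvdPowAtTwoRTRelaxedIndexShaOnHabitat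
import Summits.BirchSwinnertonDyer.BirchSwinnertonDyer.Theorems.GenusKolyvaginAtTwoOffCutResidualAtTwoRLw2FlatRankDescent
import Summits.BirchSwinnertonDyer.BirchSwinnertonDyer.Theorems.GenusKolyvaginAtTwoOffCutResidualAtTwoRLw2FlatShaFinite
import HarnessLib

/-!
# Route `GenusKolyvaginAtTwo`, LINE 26 «lw2_phantom_exclusion» of the residual crux `OffCutResidualAtTwoR` (stmt-BirchSwinnertonDyer-31767):
# the FLAT re-thread — part B2: **`Ш(E/ℚ)[2^∞]` finite of square order, (CTQ), the twin's `Ш[2] = 0` and the relaxed index (R′) — from `(NPh at 2N)` instead of an odd multiplicative prime**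

Seat `bsd-line-gk2-p5` g40 (WIDTH-5 attach, cell `bsd-f1-sign2`), `--supports stmt-BirchSwinnertonDyer-31767` (helper; closes nothing).
THEOREMS ONLY (no definition, no named fact, no `sorry`).  **BSD is NOT proved by any of this**; the residual crux is NOT closed by it.

WHY.  LINE 26 (`Cruxes/OffCutResidualAtTwoR/Lines/lw2_phantom_exclusion.lean`, stubs `stub_Q3flat` / `stub_Q4flat`) asks for the LANDED
exactness theorems Q3R_T (`…Theorems.equivariantKolyvaginExactAtTwoRT_proof`) and Q4_T″ (`…Theorems.kolyvaginExactAtTwoPosDiscT_proof`) with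
their binder quadruple `(v) (h2v : 2 ∉ v) (hNv : N ∈ v) (hmult : E multiplicative at v)` REPLACED by the hypothesis it was only ever used to
derive (critic #471 P1 census, card §7: 10 entry points, 36 pass-through signatures, 0 other uses of `v`):
`(NPh at 2N)(E, K)` := «for every `M ≥ 1`, a class of `H¹(K, E[2^M])` that dies on `Γ_(K(E[2^M]))` and is Kummer at every place over `2N`
is `0`» — VERBATIM the conclusion of `GenusExact.NonPhantomPow.nonPhantomAtTwo_of_hasMultiplicativeReductionAt` (with `N := N_E`).
Proofs below are the landed ones VERBATIM except that (i) the binder quadruple is gone and `hNPh` is inserted right after the two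
`¬ IsSquare` clauses (where `K` is in scope), (ii) at the entry points the local `(NPh_M)` is read off `hNPh` instead of the multiplicative
prime, (iii) callees are the `_flat` siblings.  Decl names = originals + `_flat`; namespaces unchanged.

WHAT (this part).  The ℚ-side / Cassels–Tate corollaries of part B1 and the twin's Ш-triviality: gk2-p5 g29's `…RTShaFiniteAtTwoRat` (`Ш(E/ℚ)[2^∞]` finite, of
square order) and `…RTShaFiniteAtTwoCTQ` ((CTQ): `#Ш(E/ℚ)[2^∞] ∣ (#Ш(E/ℚ)[2])^e`-type bounds), gk2-p4 g22's `…RTShaFiniteAtTwoTwinShaTrivial`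
(`rank E(ℚ) = 0`, `rank E^(d_K)(ℚ) = 1`, `Ш(E^(d_K)/ℚ)[2] = 0` on the minimal-twin cut) and gk2-p3's `SelmerDescent.natCard_comap_resBaseChange_shaPrimary_le_onHabitat`
(relaxed index (R′)).  Imports parts A1 (`…Lw2FlatRankDescent`) and B1 (`…Lw2FlatShaFinite`).

References: [GrossLMS1991] §1, §5, §10; [Kolyvagin1990] Thm. A; [McCallumLMS1991] §1, §3, §5; [Kramer1981] Thm. 1; [LawsonWuthrich2016] §4, §8
(the level-2 phantom class that supplies `(NPh at 2N)` off the cut — LINE 26 stubs `stub_KLW` / `stub_transport`, other seats).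
-/

set_option autoImplicit false
-- the Theorems namespace of this sub repeats the summit name by design (D-0017 nested layout)
set_option linter.dupNamespace false

noncomputable section

universe u

/-! ## from `GenusKolyvaginAtTwoShaCardDvdPowAtTwoRTShaFiniteAtTwoRat` -/

open scoped Classical
open scoped AddSubgroup

namespace Summit.BirchSwinnertonDyer.BirchSwinnertonDyer.Theorems.GenusExact.PlusDescent

open WeierstrassCurve NumberField IsDedekindDomain Field Literature.NumberTheory.EllipticCurves
  Literature.NumberTheory.GaloisRepresentations Literature.NumberTheory.EllipticCurves.ModularForms AddSubgroup
open Summit.BirchSwinnertonDyer.BirchSwinnertonDyer.Theses.GenusKolyvaginAtTwo (KolyvaginRelationAtTwo)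
open Summit.BirchSwinnertonDyer.Rank1Residual
open Literature.GroupTheory.FiniteAbelian (IsLevelPairing)

/-- (LINE 26 FLAT form: the hypothesis `(NPh at 2N)(E, K)` replaces the odd multiplicative prime `v`.) **`Ш(E/ℚ)[2^∞]` is FINITE on U_T's frame** (from the `K`-side finiteness `finite_primaryComponent_sha_two_onHabitat_flat` by the tree's corank
bookkeeping `finite_primaryComponent_sha_of_finite_baseChange_quadratic`; equivalently from `Ш(E/ℚ)[2^∞] = Ш(E/ℚ)[2^(M₀+3)]` and AEC X.4.2 (b)).
[cite: Kolyvagin1990, Thm. A] [cite: Dokchitser2013ParityNotes, §4] [cite: SilvermanAEC2009, Thm. X.4.2 (b)] -/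
theorem finite_primaryComponent_sha_rat_two_onHabitat_flat (hQ2 : KolyvaginRelationAtTwo)
    (W : WeierstrassCurve ℚ) [W.IsElliptic] [W.IsGloballyMinimal] [NeZero (W.conductorNorm ℤ)] (hcm : ¬ W.HasCM)
    (hT : Odd W.tamagawaProduct) (hneg : W.Δ < 0)
    (K : Type) [Field K] [NumberField K] (hIQ : IsImaginaryQuadratic K) (hodd : Odd (NumberField.discr K))
    (h3 : NumberField.discr K ≠ -3) (hHe : SatisfiesHeegnerHypothesis (W.conductorNorm ℤ) K)
    (hsq1 : ¬ IsSquare ((NumberField.discr K : ℚ) * -|W.Δ|)) (hsq2 : ¬ IsSquare ((NumberField.discr K : ℚ) * (-(2 * |W.Δ|))))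
    (hNPh : ∀ (Mlev : ℕ), 1 ≤ Mlev → ∀ z : galH1Torsion (W.baseChange K) ((2 ^ Mlev : ℕ) : ℤ),
      (∀ ρ ∈ torsionFixing (W.baseChange K) ((2 ^ Mlev : ℕ) : ℤ), h1Eval (W.baseChange K) ((2 ^ Mlev : ℕ) : ℤ) z ρ = 0) →
      (∀ w : HeightOneSpectrum (𝓞 K), ((2 * W.conductorNorm ℤ : ℕ) : 𝓞 K) ∈ w.asIdeal →
        z ∈ selmerLocalKer (W.baseChange K) (w.adicCompletion K) ((2 ^ Mlev : ℕ) : ℤ)) → z = 0)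
    (hρ : ∀ n : ℕ, 0 < n → W.HasSurjectiveModNGaloisRep ((2 : ℤ) ^ n))
    (Dt : ModularParametrizationData W (W.conductorNorm ℤ)) (β : ℤ) (ι : K →+* ℂ) (d₁ : KolyvaginHeegnerData Dt β ι 1) (M₀ : ℕ)
    (hndiv : ¬ ∃ Q : (W.baseChange (ringClassField K ι 1)).toAffine.Point, ((2 ^ (M₀ + 1) : ℕ) : ℤ) • Q = d₁.derivedPoint) :
    Finite (AddCommGroup.primaryComponent W.sha 2) := by
  haveI : Fact (Nat.Prime 2) := ⟨Nat.prime_two⟩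
  haveI := finite_primaryComponent_sha_two_onHabitat_flat hQ2 W hcm hT hneg K hIQ hodd h3 hHe hsq1 hsq2 hNPh hρ Dt β ι d₁ M₀ hndiv
  exact (finite_primaryComponent_sha_of_finite_baseChange_quadratic W K hIQ.1 2).1

/-- (LINE 26 FLAT form: the hypothesis `(NPh at 2N)(E, K)` replaces the odd multiplicative prime `v`.) **`#Ш(E/ℚ)[2^∞] = 2^(2t)` on U_T's frame** (finite `2`-group; Cassels–Tate squareness over `ℚ`, `CasselsTateNumberField.isSquare_natCard_primaryComponent_sha`).
[cite: SilvermanAEC2009, Thm. X.4.14] [cite: Kolyvagin1990, Thm. A] -/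
theorem exists_natCard_primaryComponent_sha_rat_two_eq_pow_two_mul_onHabitat_flat (hQ2 : KolyvaginRelationAtTwo)
    (W : WeierstrassCurve ℚ) [W.IsElliptic] [W.IsGloballyMinimal] [NeZero (W.conductorNorm ℤ)] (hcm : ¬ W.HasCM)
    (hT : Odd W.tamagawaProduct) (hneg : W.Δ < 0)
    (K : Type) [Field K] [NumberField K] (hIQ : IsImaginaryQuadratic K) (hodd : Odd (NumberField.discr K))
    (h3 : NumberField.discr K ≠ -3) (hHe : SatisfiesHeegnerHypothesis (W.conductorNorm ℤ) K)
    (hsq1 : ¬ IsSquare ((NumberField.discr K : ℚ) * -|W.Δ|)) (hsq2 : ¬ IsSquare ((NumberField.discr K : ℚ) * (-(2 * |W.Δ|))))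
    (hNPh : ∀ (Mlev : ℕ), 1 ≤ Mlev → ∀ z : galH1Torsion (W.baseChange K) ((2 ^ Mlev : ℕ) : ℤ),
      (∀ ρ ∈ torsionFixing (W.baseChange K) ((2 ^ Mlev : ℕ) : ℤ), h1Eval (W.baseChange K) ((2 ^ Mlev : ℕ) : ℤ) z ρ = 0) →
      (∀ w : HeightOneSpectrum (𝓞 K), ((2 * W.conductorNorm ℤ : ℕ) : 𝓞 K) ∈ w.asIdeal →
        z ∈ selmerLocalKer (W.baseChange K) (w.adicCompletion K) ((2 ^ Mlev : ℕ) : ℤ)) → z = 0)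
    (hρ : ∀ n : ℕ, 0 < n → W.HasSurjectiveModNGaloisRep ((2 : ℤ) ^ n))
    (Dt : ModularParametrizationData W (W.conductorNorm ℤ)) (β : ℤ) (ι : K →+* ℂ) (d₁ : KolyvaginHeegnerData Dt β ι 1) (M₀ : ℕ)
    (hndiv : ¬ ∃ Q : (W.baseChange (ringClassField K ι 1)).toAffine.Point, ((2 ^ (M₀ + 1) : ℕ) : ℤ) • Q = d₁.derivedPoint) :
    ∃ t : ℕ, Nat.card (AddCommGroup.primaryComponent W.sha 2) = 2 ^ (2 * t) := by
  haveI : Fact (Nat.Prime 2) := ⟨Nat.prime_two⟩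
  haveI := finite_primaryComponent_sha_rat_two_onHabitat_flat hQ2 W hcm hT hneg K hIQ hodd h3 hHe hsq1 hsq2 hNPh hρ Dt β ι d₁ M₀ hndiv
  obtain ⟨k, hk⟩ := exists_natCard_addPrimaryComponent_eq_pow (A := W.sha) 2
  obtain ⟨r, hr⟩ := CasselsTateNumberField.isSquare_natCard_primaryComponent_sha W 2
  have hr2 : r * r = 2 ^ k := by rw [← hr, hk]
  have hrdvd : r ∣ 2 ^ k := ⟨r, hr2.symm⟩
  obtain ⟨t, -, rfl⟩ := (Nat.dvd_prime_pow Nat.prime_two).mp hrdvd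
  exact ⟨t, by rw [hr, ← pow_add, two_mul]⟩

end Summit.BirchSwinnertonDyer.BirchSwinnertonDyer.Theorems.GenusExact.PlusDescent

/-! ## from `GenusKolyvaginAtTwoShaCardDvdPowAtTwoRTShaFiniteAtTwoCTQ` -/

open scoped Classical
open scoped AddSubgroup

namespace Summit.BirchSwinnertonDyer.BirchSwinnertonDyer.Theorems.GenusExact.PlusDescent

open WeierstrassCurve NumberField IsDedekindDomain Field Literature.NumberTheory.EllipticCurves
  Literature.NumberTheory.GaloisRepresentations Literature.NumberTheory.EllipticCurves.ModularForms AddSubgroup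
open Summit.BirchSwinnertonDyer.BirchSwinnertonDyer.Theses.GenusKolyvaginAtTwo (KolyvaginRelationAtTwo)
open Summit.BirchSwinnertonDyer.Rank1Residual

/-- (LINE 26 FLAT form: the hypothesis `(NPh at 2N)(E, K)` replaces the odd multiplicative prime `v`.) **(CTQ) over `ℚ`: exponent + `2`-rank ⟹ order.**  On U_T's frame: if `2^e` kills `Ш(E/ℚ)[2^∞]` (e.g. (B2Q), `e = M₀`) and `#(Ш(E/ℚ)[2^∞])[2] ≤ 4`
(e.g. (RANKQ), `dim Ш(E/ℚ)[2] ≤ 2`), then `#Ш(E/ℚ)[2^∞] ∣ 2^(2e)` — because `#Ш(E/ℚ)[2^∞] = 4^t′` (`…RTShaFiniteAtTwoRat`: finite + Cassels–Tate squareness)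
and `4^t′ ≤ (#Ш[2])^e ≤ 4^e` (§1).  No structure theorem `Ш ≅ (ℤ/2^t′)²` is needed. [cite: McCallumLMS1991, §5 Cor. 5.6] [cite: Kolyvagin1989Izv, Thm. B₂]
[cite: SilvermanAEC2009, Thm. X.4.14] -/
theorem natCard_primaryComponent_sha_rat_two_dvd_of_exponent_of_card_two_torsion_le_onHabitat_flat (hQ2 : KolyvaginRelationAtTwo)
    (W : WeierstrassCurve ℚ) [W.IsElliptic] [W.IsGloballyMinimal] [NeZero (W.conductorNorm ℤ)] (hcm : ¬ W.HasCM)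
    (hT : Odd W.tamagawaProduct) (hneg : W.Δ < 0)
    (K : Type) [Field K] [NumberField K] (hIQ : IsImaginaryQuadratic K) (hodd : Odd (NumberField.discr K))
    (h3 : NumberField.discr K ≠ -3) (hHe : SatisfiesHeegnerHypothesis (W.conductorNorm ℤ) K)
    (hsq1 : ¬ IsSquare ((NumberField.discr K : ℚ) * -|W.Δ|)) (hsq2 : ¬ IsSquare ((NumberField.discr K : ℚ) * (-(2 * |W.Δ|))))
    (hNPh : ∀ (Mlev : ℕ), 1 ≤ Mlev → ∀ z : galH1Torsion (W.baseChange K) ((2 ^ Mlev : ℕ) : ℤ),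
      (∀ ρ ∈ torsionFixing (W.baseChange K) ((2 ^ Mlev : ℕ) : ℤ), h1Eval (W.baseChange K) ((2 ^ Mlev : ℕ) : ℤ) z ρ = 0) →
      (∀ w : HeightOneSpectrum (𝓞 K), ((2 * W.conductorNorm ℤ : ℕ) : 𝓞 K) ∈ w.asIdeal →
        z ∈ selmerLocalKer (W.baseChange K) (w.adicCompletion K) ((2 ^ Mlev : ℕ) : ℤ)) → z = 0)
    (hρ : ∀ n : ℕ, 0 < n → W.HasSurjectiveModNGaloisRep ((2 : ℤ) ^ n))
    (Dt : ModularParametrizationData W (W.conductorNorm ℤ)) (β : ℤ) (ι : K →+* ℂ) (d₁ : KolyvaginHeegnerData Dt β ι 1) (M₀ : ℕ)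
    (hndiv : ¬ ∃ Q : (W.baseChange (ringClassField K ι 1)).toAffine.Point, ((2 ^ (M₀ + 1) : ℕ) : ℤ) • Q = d₁.derivedPoint)
    {e : ℕ} (hexp : ∀ x ∈ AddCommGroup.primaryComponent W.sha 2, 2 ^ e • x = 0)
    (hrk : Nat.card ((AddCommGroup.primaryComponent W.sha 2)[(2 : ℕ)]) ≤ 4) :
    Nat.card (AddCommGroup.primaryComponent W.sha 2) ∣ 2 ^ (2 * e) := by
  haveI := finite_primaryComponent_sha_rat_two_onHabitat_flat hQ2 W hcm hT hneg K hIQ hodd h3 hHe hsq1 hsq2 hNPh hρ Dt β ι d₁ M₀ hndiv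
  obtain ⟨t, ht⟩ := exists_natCard_primaryComponent_sha_rat_two_eq_pow_two_mul_onHabitat_flat hQ2 W hcm hT hneg K hIQ hodd h3
    hHe hsq1 hsq2 hNPh hρ Dt β ι d₁ M₀ hndiv
  have hle := natCard_le_natCard_torsionBy_pow (A := AddCommGroup.primaryComponent W.sha 2) 2
    (fun x ↦ Subtype.ext (by rw [AddSubgroupClass.coe_nsmul, ZeroMemClass.coe_zero]; exact hexp x x.2))
  rw [ht] at hle ⊢
  exact pow_two_mul_dvd_of_le_pow hrk hle

/-- (LINE 26 FLAT form: the hypothesis `(NPh at 2N)(E, K)` replaces the odd multiplicative prime `v`.) **(CTQ) over `ℚ`, `Ш(E/ℚ)[2]`-currency**: the same with the `2`-rank hypothesis on `#Ш(E/ℚ)[2]` (`= #(Ш(E/ℚ)[2^∞])[2]`,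
`CasselsTateNumberField.natCard_sha_torsionBy_pow_eq_primaryComponent`).  With (B2Q) `e = M₀` and (RANKQ) `#Ш(E/ℚ)[2] ≤ 4` this is PAIRCOUNT's
conclusion `#Ш(E/ℚ)[2^∞] ∣ 4^M₀` verbatim. [cite: McCallumLMS1991, §5 Cor. 5.6] [cite: Kolyvagin1989Izv, Thm. B₂] [cite: SilvermanAEC2009, Thm. X.4.14] -/
theorem natCard_primaryComponent_sha_rat_two_dvd_of_exponent_of_card_sha_two_torsion_le_onHabitat_flat (hQ2 : KolyvaginRelationAtTwo)
    (W : WeierstrassCurve ℚ) [W.IsElliptic] [W.IsGloballyMinimal] [NeZero (W.conductorNorm ℤ)] (hcm : ¬ W.HasCM)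
    (hT : Odd W.tamagawaProduct) (hneg : W.Δ < 0)
    (K : Type) [Field K] [NumberField K] (hIQ : IsImaginaryQuadratic K) (hodd : Odd (NumberField.discr K))
    (h3 : NumberField.discr K ≠ -3) (hHe : SatisfiesHeegnerHypothesis (W.conductorNorm ℤ) K)
    (hsq1 : ¬ IsSquare ((NumberField.discr K : ℚ) * -|W.Δ|)) (hsq2 : ¬ IsSquare ((NumberField.discr K : ℚ) * (-(2 * |W.Δ|))))
    (hNPh : ∀ (Mlev : ℕ), 1 ≤ Mlev → ∀ z : galH1Torsion (W.baseChange K) ((2 ^ Mlev : ℕ) : ℤ),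
      (∀ ρ ∈ torsionFixing (W.baseChange K) ((2 ^ Mlev : ℕ) : ℤ), h1Eval (W.baseChange K) ((2 ^ Mlev : ℕ) : ℤ) z ρ = 0) →
      (∀ w : HeightOneSpectrum (𝓞 K), ((2 * W.conductorNorm ℤ : ℕ) : 𝓞 K) ∈ w.asIdeal →
        z ∈ selmerLocalKer (W.baseChange K) (w.adicCompletion K) ((2 ^ Mlev : ℕ) : ℤ)) → z = 0)
    (hρ : ∀ n : ℕ, 0 < n → W.HasSurjectiveModNGaloisRep ((2 : ℤ) ^ n))
    (Dt : ModularParametrizationData W (W.conductorNorm ℤ)) (β : ℤ) (ι : K →+* ℂ) (d₁ : KolyvaginHeegnerData Dt β ι 1) (M₀ : ℕ)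
    (hndiv : ¬ ∃ Q : (W.baseChange (ringClassField K ι 1)).toAffine.Point, ((2 ^ (M₀ + 1) : ℕ) : ℤ) • Q = d₁.derivedPoint)
    {e : ℕ} (hexp : ∀ x ∈ AddCommGroup.primaryComponent W.sha 2, 2 ^ e • x = 0)
    (hrk : Nat.card (AddSubgroup.torsionBy W.sha ((2 : ℕ) : ℤ)) ≤ 4) :
    Nat.card (AddCommGroup.primaryComponent W.sha 2) ∣ 2 ^ (2 * e) := by
  haveI : Fact (Nat.Prime 2) := ⟨Nat.prime_two⟩
  refine natCard_primaryComponent_sha_rat_two_dvd_of_exponent_of_card_two_torsion_le_onHabitat_flat hQ2 W hcm hT hneg K hIQ hodd h3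
    hHe hsq1 hsq2 hNPh hρ Dt β ι d₁ M₀ hndiv hexp ?_
  have h := CasselsTateNumberField.natCard_sha_torsionBy_pow_eq_primaryComponent W 2 1
  rw [pow_one] at h
  rw [← h]
  exact hrk

end Summit.BirchSwinnertonDyer.BirchSwinnertonDyer.Theorems.GenusExact.PlusDescent

/-! ## from `GenusKolyvaginAtTwoShaCardDvdPowAtTwoRTShaFiniteAtTwoTwinShaTrivial` -/

open scoped Classical
open scoped AddSubgroup

namespace Summit.BirchSwinnertonDyer.BirchSwinnertonDyer.Theorems.GenusExact.PlusDescent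

open WeierstrassCurve NumberField IsDedekindDomain Field Literature.NumberTheory.EllipticCurves
  Literature.NumberTheory.GaloisRepresentations Literature.NumberTheory.EllipticCurves.ModularForms AddSubgroup
open Summit.BirchSwinnertonDyer.BirchSwinnertonDyer.Theses.GenusKolyvaginAtTwo (KolyvaginRelationAtTwo)
open Summit.BirchSwinnertonDyer.Rank1Residual

/-- (LINE 26 FLAT form: the hypothesis `(NPh at 2N)(E, K)` replaces the odd multiplicative prime `v`.) **`rank E(ℚ) = 0` and `rank Wd(ℚ) = 1` on U_T's frame with `w(E) = +1`**, for every elliptic `ℚ`-model `Wd` of `E^(d_K)`: `rank E(K) = 1`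
(gk2-p4 `mordellWeilRank_baseChange_eq_one_onHabitat_flat`), the `K`-rational Heegner point under `P(1)` is non-torsion, and (R0)
(`rankZero_side_of_rootNumber`: `w = 1` ⟹ `rank E(ℚ) = 0`); `rank E(ℚ) + rank E^(d_K)(ℚ) = rank E(K)` (`mordellWeilRank_add_eq_of_baseChange`)
and model invariance of the rank. [cite: GrossLMS1991, Thm. 1.3, §5 Prop. 5.3] [cite: Kolyvagin1990, Thm. A] [cite: SilvermanAEC2009, Exercise 10.16] -/
theorem mordellWeilRank_rat_eq_zero_and_twin_eq_one_onHabitat_flat (hQ2 : KolyvaginRelationAtTwo)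
    (W : WeierstrassCurve ℚ) [W.IsElliptic] [W.IsGloballyMinimal] [NeZero (W.conductorNorm ℤ)] (hcm : ¬ W.HasCM)
    (hT : Odd W.tamagawaProduct) (hneg : W.Δ < 0)
    (K : Type) [Field K] [NumberField K] (hIQ : IsImaginaryQuadratic K) (hodd : Odd (NumberField.discr K))
    (h3 : NumberField.discr K ≠ -3) (hHe : SatisfiesHeegnerHypothesis (W.conductorNorm ℤ) K)
    (hsq1 : ¬ IsSquare ((NumberField.discr K : ℚ) * -|W.Δ|)) (hsq2 : ¬ IsSquare ((NumberField.discr K : ℚ) * (-(2 * |W.Δ|))))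
    (hNPh : ∀ (Mlev : ℕ), 1 ≤ Mlev → ∀ z : galH1Torsion (W.baseChange K) ((2 ^ Mlev : ℕ) : ℤ),
      (∀ ρ ∈ torsionFixing (W.baseChange K) ((2 ^ Mlev : ℕ) : ℤ), h1Eval (W.baseChange K) ((2 ^ Mlev : ℕ) : ℤ) z ρ = 0) →
      (∀ w : HeightOneSpectrum (𝓞 K), ((2 * W.conductorNorm ℤ : ℕ) : 𝓞 K) ∈ w.asIdeal →
        z ∈ selmerLocalKer (W.baseChange K) (w.adicCompletion K) ((2 ^ Mlev : ℕ) : ℤ)) → z = 0)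
    (hρ : ∀ n : ℕ, 0 < n → W.HasSurjectiveModNGaloisRep ((2 : ℤ) ^ n))
    (Dt : ModularParametrizationData W (W.conductorNorm ℤ)) (β : ℤ) (ι : K →+* ℂ) (d₁ : KolyvaginHeegnerData Dt β ι 1)
    (hnt : ¬ IsOfFinAddOrder d₁.derivedPoint) (M₀ : ℕ)
    (hndiv : ¬ ∃ Q : (W.baseChange (ringClassField K ι 1)).toAffine.Point, ((2 ^ (M₀ + 1) : ℕ) : ℤ) • Q = d₁.derivedPoint)
    (hw1 : W.rootNumber = 1)
    (Wd : WeierstrassCurve ℚ) [Wd.IsElliptic] (hWd : ∃ C : VariableChange ℚ, C • W.quadraticTwist (NumberField.discr K : ℚ) = Wd) :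
    W.mordellWeilRank = 0 ∧ Wd.mordellWeilRank = 1 := by
  haveI hell : (W.baseChange K).IsElliptic := inferInstanceAs ((W.map (algebraMap ℚ K)).IsElliptic)
  have h2 : Module.finrank ℚ K = 2 := hIQ.1
  have hs2 : W.HasSurjectiveModNGaloisRep 2 := by simpa using hρ 1 one_pos
  have hdK : (NumberField.discr K : ℚ) ≠ 0 := by exact_mod_cast NumberField.discr_ne_zero K
  haveI := W.isElliptic_quadraticTwist hdK
  -- `rank E(K) = 1`
  have hrk := mordellWeilRank_baseChange_eq_one_onHabitat_flat hQ2 W hcm hT hneg K hIQ hodd h3 hHe hsq1 hsq2 hNPh hρ Dt β ι d₁ hnt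
    M₀ hndiv
  -- the `K`-rational Heegner point under `P(1)`, of infinite order
  obtain ⟨P₀, hHP, hP₀⟩ := AdditiveKoly.exists_isHeegnerPoint_map_eq_derivedPoint_one (W := W) (K := K) (Dt := Dt) (β := β) (ι := ι)
    hIQ hHe d₁
  have hP₀nt : ¬ IsOfFinAddOrder P₀ := fun h ↦ hnt (by rw [← hP₀]; exact AddMonoidHom.isOfFinAddOrder _ h)
  -- (R0): `w = 1` ⟹ `rank E(ℚ) = 0`
  have hW0 : W.mordellWeilRank = 0 := by
    rcases rankZero_side_of_rootNumber K W hIQ hHe hs2 hrk hHP hP₀nt (Wd := Wd) hWd with ⟨-, h0, -⟩ | ⟨hw, -, -⟩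
    · exact h0
    · exfalso
      rw [hw1] at hw
      norm_num at hw
  -- `rank E + rank E^(d) = 1`
  have hsum := W.mordellWeilRank_add_eq_of_baseChange K h2 one_ne_zero hrk
  rw [hW0, zero_add] at hsum
  obtain ⟨Cd, rfl⟩ := hWd
  exact ⟨hW0, by rw [(W.quadraticTwist (NumberField.discr K : ℚ)).mordellWeilRank_variableChange_holds Cd, hsum]⟩

/-- (LINE 26 FLAT form: the hypothesis `(NPh at 2N)(E, K)` replaces the odd multiplicative prime `v`.) **`Ш(Wd/ℚ)[2] = 0` on the live configuration**: on U_T's frame with `w(E) = +1` and a 2-Selmer-minimal elliptic `ℚ`-model `Wd ≅ E^(d_K)`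
(`#Sel₂(Wd) = 2`), `#(Ш(Wd/ℚ) ∩ H¹(ℚ,Wd)[2]) = 1` — the descent count `#Sel₂(Wd) = 2^(rank Wd(ℚ)) · #Wd(ℚ)[2] · #Ш(Wd/ℚ)[2]` (AEC X.4.2,
`card_selmerGroup_eq_pow_rank_mul`) with `rank = 1` (§1) and `Wd(ℚ)[2] = 0` (§2). [cite: SilvermanAEC2009, Thm. X.4.2 (a)] [cite: MazurRubin2010, §1] -/
theorem natCard_sha_inf_torsionBy_two_twin_eq_one_onHabitat_flat (hQ2 : KolyvaginRelationAtTwo)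
    (W : WeierstrassCurve ℚ) [W.IsElliptic] [W.IsGloballyMinimal] [NeZero (W.conductorNorm ℤ)] (hcm : ¬ W.HasCM)
    (hT : Odd W.tamagawaProduct) (hneg : W.Δ < 0)
    (K : Type) [Field K] [NumberField K] (hIQ : IsImaginaryQuadratic K) (hodd : Odd (NumberField.discr K))
    (h3 : NumberField.discr K ≠ -3) (hHe : SatisfiesHeegnerHypothesis (W.conductorNorm ℤ) K)
    (hsq1 : ¬ IsSquare ((NumberField.discr K : ℚ) * -|W.Δ|)) (hsq2 : ¬ IsSquare ((NumberField.discr K : ℚ) * (-(2 * |W.Δ|))))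
    (hNPh : ∀ (Mlev : ℕ), 1 ≤ Mlev → ∀ z : galH1Torsion (W.baseChange K) ((2 ^ Mlev : ℕ) : ℤ),
      (∀ ρ ∈ torsionFixing (W.baseChange K) ((2 ^ Mlev : ℕ) : ℤ), h1Eval (W.baseChange K) ((2 ^ Mlev : ℕ) : ℤ) z ρ = 0) →
      (∀ w : HeightOneSpectrum (𝓞 K), ((2 * W.conductorNorm ℤ : ℕ) : 𝓞 K) ∈ w.asIdeal →
        z ∈ selmerLocalKer (W.baseChange K) (w.adicCompletion K) ((2 ^ Mlev : ℕ) : ℤ)) → z = 0)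
    (hρ : ∀ n : ℕ, 0 < n → W.HasSurjectiveModNGaloisRep ((2 : ℤ) ^ n))
    (Dt : ModularParametrizationData W (W.conductorNorm ℤ)) (β : ℤ) (ι : K →+* ℂ) (d₁ : KolyvaginHeegnerData Dt β ι 1)
    (hnt : ¬ IsOfFinAddOrder d₁.derivedPoint) (M₀ : ℕ)
    (hndiv : ¬ ∃ Q : (W.baseChange (ringClassField K ι 1)).toAffine.Point, ((2 ^ (M₀ + 1) : ℕ) : ℤ) • Q = d₁.derivedPoint)
    (hw1 : W.rootNumber = 1)
    (Wd : WeierstrassCurve ℚ) [Wd.IsElliptic] (hWd : ∃ C : VariableChange ℚ, C • W.quadraticTwist (NumberField.discr K : ℚ) = Wd)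
    (hSel : Nat.card (Wd.selmerGroup 2) = 2) :
    Nat.card (Wd.sha ⊓ AddSubgroup.torsionBy Wd.galH1 (2 : ℕ) : AddSubgroup Wd.galH1) = 1 := by
  have hrank := (mordellWeilRank_rat_eq_zero_and_twin_eq_one_onHabitat_flat hQ2 W hcm hT hneg K hIQ hodd h3 hHe hsq1 hsq2 hNPh hρ Dt β ι
    d₁ hnt M₀ hndiv hw1 Wd hWd).2
  have hcount := card_selmerGroup_eq_pow_rank_mul Wd 2
  simp only [Nat.cast_ofNat] at hcount ⊢
  rw [hSel, hrank, pow_one, mul_assoc] at hcount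
  -- `2 · 1 = 2 · (#Wd(ℚ)[2] · #(Ш ∩ H¹[2]))` forces the product, hence the second factor, to be `1`
  have hcd := Nat.eq_of_mul_eq_mul_left (show 0 < 2 by norm_num) ((mul_one 2).trans hcount)
  exact Nat.eq_one_of_mul_eq_one_left hcd.symm

/-- (LINE 26 FLAT form: the hypothesis `(NPh at 2N)(E, K)` replaces the odd multiplicative prime `v`.) **`Ш(Wd/ℚ)[2^∞] = 0` on the live configuration** («`Zp = ⊥`»; LEAD memo R7 §1a): every class of `Ш(Wd/ℚ)` of `2`-power order is `0`, since a
non-zero one would have a multiple of order exactly `2` in `Ш(Wd/ℚ)[2] = 0` (§3).  Input of SANDWICH′ (A) (τ acts trivially on `Ш(E/K)[2^∞]`: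
`(1 − τ)X = res′ cores′ X ⊆ res′ Ш(Wd/ℚ)[2^∞] = 0`) and of the adaptive telescope's `Zp`. [cite: SilvermanAEC2009, Thm. X.4.2 (a)]
[cite: GrossLMS1991, Thm. 1.3] [cite: MazurRubin2010, §1] -/
theorem forall_primaryComponent_sha_twin_two_eq_zero_onHabitat_flat (hQ2 : KolyvaginRelationAtTwo)
    (W : WeierstrassCurve ℚ) [W.IsElliptic] [W.IsGloballyMinimal] [NeZero (W.conductorNorm ℤ)] (hcm : ¬ W.HasCM)
    (hT : Odd W.tamagawaProduct) (hneg : W.Δ < 0)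
    (K : Type) [Field K] [NumberField K] (hIQ : IsImaginaryQuadratic K) (hodd : Odd (NumberField.discr K))
    (h3 : NumberField.discr K ≠ -3) (hHe : SatisfiesHeegnerHypothesis (W.conductorNorm ℤ) K)
    (hsq1 : ¬ IsSquare ((NumberField.discr K : ℚ) * -|W.Δ|)) (hsq2 : ¬ IsSquare ((NumberField.discr K : ℚ) * (-(2 * |W.Δ|))))
    (hNPh : ∀ (Mlev : ℕ), 1 ≤ Mlev → ∀ z : galH1Torsion (W.baseChange K) ((2 ^ Mlev : ℕ) : ℤ),
      (∀ ρ ∈ torsionFixing (W.baseChange K) ((2 ^ Mlev : ℕ) : ℤ), h1Eval (W.baseChange K) ((2 ^ Mlev : ℕ) : ℤ) z ρ = 0) →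
      (∀ w : HeightOneSpectrum (𝓞 K), ((2 * W.conductorNorm ℤ : ℕ) : 𝓞 K) ∈ w.asIdeal →
        z ∈ selmerLocalKer (W.baseChange K) (w.adicCompletion K) ((2 ^ Mlev : ℕ) : ℤ)) → z = 0)
    (hρ : ∀ n : ℕ, 0 < n → W.HasSurjectiveModNGaloisRep ((2 : ℤ) ^ n))
    (Dt : ModularParametrizationData W (W.conductorNorm ℤ)) (β : ℤ) (ι : K →+* ℂ) (d₁ : KolyvaginHeegnerData Dt β ι 1)
    (hnt : ¬ IsOfFinAddOrder d₁.derivedPoint) (M₀ : ℕ)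
    (hndiv : ¬ ∃ Q : (W.baseChange (ringClassField K ι 1)).toAffine.Point, ((2 ^ (M₀ + 1) : ℕ) : ℤ) • Q = d₁.derivedPoint)
    (hw1 : W.rootNumber = 1)
    (Wd : WeierstrassCurve ℚ) [Wd.IsElliptic] (hWd : ∃ C : VariableChange ℚ, C • W.quadraticTwist (NumberField.discr K : ℚ) = Wd)
    (hSel : Nat.card (Wd.selmerGroup 2) = 2) :
    ∀ x ∈ AddCommGroup.primaryComponent Wd.sha 2, x = 0 := by
  have h1 := natCard_sha_inf_torsionBy_two_twin_eq_one_onHabitat_flat hQ2 W hcm hT hneg K hIQ hodd h3 hHe hsq1 hsq2 hNPh hρ Dt β ι d₁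
    hnt M₀ hndiv hw1 Wd hWd hSel
  have hsub : Subsingleton (Wd.sha ⊓ AddSubgroup.torsionBy Wd.galH1 (2 : ℕ) : AddSubgroup Wd.galH1) := (Nat.card_eq_one_iff_unique.mp h1).1
  intro x hx
  by_contra hx0
  obtain ⟨k, hk⟩ := (AddCommGroup.mem_primaryComponent).1 hx
  -- the order of `x` is `2^e` with `e ≥ 1`
  obtain ⟨e, -, he⟩ := (Nat.dvd_prime_pow Nat.prime_two).mp (addOrderOf_dvd_iff_nsmul_eq_zero.mpr hk)
  have he1 : 1 ≤ e := by
    by_contra h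
    have h0 : e = 0 := by omega
    rw [h0, pow_zero, AddMonoid.addOrderOf_eq_one_iff] at he
    exact hx0 he
  -- `y = 2^(e-1) • x` has order exactly `2`
  set y : Wd.sha := 2 ^ (e - 1) • x with hy
  have hy2 : 2 • y = 0 := by
    rw [hy, ← mul_nsmul', ← pow_succ', Nat.sub_add_cancel he1, ← he]
    exact addOrderOf_nsmul_eq_zero x
  have hy0 : y ≠ 0 := by
    intro h
    have hdvd : addOrderOf x ∣ 2 ^ (e - 1) := addOrderOf_dvd_iff_nsmul_eq_zero.mpr (by rw [← hy]; exact h)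
    rw [he, Nat.pow_dvd_pow_iff_le_right (by norm_num)] at hdvd
    omega
  -- `y ∈ Ш ∩ H¹(ℚ, Wd)[2]`, a trivial group
  have hymem : ((y : Wd.sha) : Wd.galH1) ∈ (Wd.sha ⊓ AddSubgroup.torsionBy Wd.galH1 (2 : ℕ) : AddSubgroup Wd.galH1) := by
    refine AddSubgroup.mem_inf.mpr ⟨y.2, torsionBy.nsmul_iff.mpr ?_⟩
    rw [← AddSubgroupClass.coe_nsmul, hy2, ZeroMemClass.coe_zero]
  have h0 : (⟨((y : Wd.sha) : Wd.galH1), hymem⟩ : (Wd.sha ⊓ AddSubgroup.torsionBy Wd.galH1 (2 : ℕ) : AddSubgroup Wd.galH1)) =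
      ⟨0, AddSubgroup.zero_mem _⟩ := Subsingleton.elim _ _
  have hval : ((y : Wd.sha) : Wd.galH1) = 0 := congrArg Subtype.val h0
  exact hy0 (Subtype.ext hval)

end Summit.BirchSwinnertonDyer.BirchSwinnertonDyer.Theorems.GenusExact.PlusDescent

/-! ## from `GenusKolyvaginAtTwoShaCardDvdPowAtTwoRTRelaxedIndexShaOnHabitat` -/

open scoped Classical

namespace Summit.BirchSwinnertonDyer.BirchSwinnertonDyer.Theorems.GenusExact.SelmerDescent

open WeierstrassCurve NumberField IsDedekindDomain Field
open Literature.NumberTheory.EllipticCurves Literature.NumberTheory.GaloisRepresentations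
open Literature.NumberTheory.EllipticCurves.ModularForms
open Summit.BirchSwinnertonDyer.BirchSwinnertonDyer.Theses.GenusKolyvaginAtTwo (KolyvaginRelationAtTwo)

/-- (LINE 26 FLAT form: the hypothesis `(NPh at 2N)(E, K)` replaces the odd multiplicative prime `v`.) **The input `hR` of the SANDWICH′ assembly, discharged on U_T's frame (`e = 1`):
`#res⁻¹(Ш(E/K)[2^∞]) ≤ #Ш(E/ℚ)[2^∞] · 2`** for every elliptic model `Wd ≅ E^(d_K)` with `ord₂ C(Wd) ≤ 1` (the live configuration of
LINE 19), `σ ≠ 1` in `Aut(K/ℚ)`.  (R) p749677 + finiteness of `Ш(E/ℚ)[2^∞]` on the frame (gk2-p5 g29) + `2^{ord₂ C(Wd)} ≤ 2`.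
[cite: Kramer1981, §2 Prop. 3 and Thm. 1] [cite: Kolyvagin1990, Thm. A] [cite: MilneADT2006, I §6] -/
theorem natCard_comap_resBaseChange_shaPrimary_le_onHabitat_flat (hQ2 : KolyvaginRelationAtTwo)
    (W : WeierstrassCurve ℚ) [W.IsElliptic] [W.IsGloballyMinimal] [NeZero (W.conductorNorm ℤ)] (hcm : ¬ W.HasCM)
    (hT : Odd W.tamagawaProduct) (hneg : W.Δ < 0)
    (K : Type) [Field K] [NumberField K] (hIQ : IsImaginaryQuadratic K) (hodd : Odd (NumberField.discr K))
    (h3 : NumberField.discr K ≠ -3) (hHe : SatisfiesHeegnerHypothesis (W.conductorNorm ℤ) K)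
    (hsq1 : ¬ IsSquare ((NumberField.discr K : ℚ) * -|W.Δ|)) (hsq2 : ¬ IsSquare ((NumberField.discr K : ℚ) * (-(2 * |W.Δ|))))
    (hNPh : ∀ (Mlev : ℕ), 1 ≤ Mlev → ∀ z : galH1Torsion (W.baseChange K) ((2 ^ Mlev : ℕ) : ℤ),
      (∀ ρ ∈ torsionFixing (W.baseChange K) ((2 ^ Mlev : ℕ) : ℤ), h1Eval (W.baseChange K) ((2 ^ Mlev : ℕ) : ℤ) z ρ = 0) →
      (∀ w : HeightOneSpectrum (𝓞 K), ((2 * W.conductorNorm ℤ : ℕ) : 𝓞 K) ∈ w.asIdeal →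
        z ∈ selmerLocalKer (W.baseChange K) (w.adicCompletion K) ((2 ^ Mlev : ℕ) : ℤ)) → z = 0)
    (hρ : ∀ n : ℕ, 0 < n → W.HasSurjectiveModNGaloisRep ((2 : ℤ) ^ n))
    (Dt : ModularParametrizationData W (W.conductorNorm ℤ)) (β : ℤ) (ι : K →+* ℂ) (d₁ : KolyvaginHeegnerData Dt β ι 1) (M₀ : ℕ)
    (hndiv : ¬ ∃ Q : (W.baseChange (ringClassField K ι 1)).toAffine.Point, ((2 ^ (M₀ + 1) : ℕ) : ℤ) • Q = d₁.derivedPoint)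
    {σ : K ≃ₐ[ℚ] K} (hσ1 : σ ≠ 1) (Wd : WeierstrassCurve ℚ) [Wd.IsElliptic]
    (hWd : ∃ C : VariableChange ℚ, C • W.quadraticTwist (NumberField.discr K : ℚ) = Wd)
    (hle : padicValNat 2 Wd.tamagawaProduct ≤ 1) :
    Nat.card (((AddCommGroup.primaryComponent (W.baseChange K).sha 2).map (W.baseChange K).sha.subtype).comap
        (resBaseChange W K)) ≤
      Nat.card (AddCommGroup.primaryComponent W.sha 2) * 2 ^ 1 := by
  obtain ⟨Cd, hCd⟩ := hWd
  have hdvd := natCard_comap_resBaseChange_shaPrimary_dvd_two_pow_onFrame W hIQ hσ1 hodd hHe hneg hT Cd hCd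
  haveI := PlusDescent.finite_primaryComponent_sha_rat_two_onHabitat_flat hQ2 W hcm hT hneg K hIQ hodd h3 hHe hsq1
    hsq2 hNPh hρ Dt β ι d₁ M₀ hndiv
  have hpos : 0 < Nat.card (AddCommGroup.primaryComponent W.sha 2) := Nat.card_pos
  refine (Nat.le_of_dvd (Nat.mul_pos hpos (pow_pos two_pos _)) hdvd).trans ?_
  exact Nat.mul_le_mul_left _ (Nat.pow_le_pow_right two_pos hle)

end Summit.BirchSwinnertonDyer.BirchSwinnertonDyer.Theorems.GenusExact.SelmerDescent

end
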